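import Summits.QuantumFields.BalabanUV.Beta.GAN24.SoftMinimiserOneStepSup
import Literature.MathematicalPhysics.QuantumFieldTheory.Balaban1983to89.B5Hk163TorusHolderRate
import Literature.MathematicalPhysics.QuantumFieldTheory.Balaban1983to89.T4EtaRateOperatorTorus

/-!
# G-an2-4 ∕ (CONV-C), road P2 — A SMALL CALCULUS OF BLOCK-LOCALISED DECAY ON BAŁABAN'S SCALAR CARRIERS: per-block row decay of a
# kernel (`RowDecay`), exponential decay of a field away from a unit site (`FieldDecay`), and the one resummation
# `RowDecay K C δ → FieldDecay g b δ y′ → FieldDecay (K·g) (C·b·K_{d+1}(δ/2)) (δ/2) y′` — the currency in which the all-sites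
# one-step laws of `SoftMinimiserOneStepSup` ∕ `HardMinimiserOneStepSup` become the row's «two clauses» (decay + rate)

Unit `b2b-balaban-gan24-p2` (gen 29), BINDER row G-an2-4 ∕ (CONV-C), road P2, route R2-S1.  The (CONV-C) shape of the row
(`GAN24/DirichletExhaustion.ConvC`, `OpClose`) is a KERNEL statement with exponential decay in the unit-lattice distance; the
one-step laws of the two minimiser files are SUP statements.  The passage is bookkeeping: every operator in the exact identities is a
product of letters (`G′∇*∇*`, `G′∇*`, `∇G′`, `∇*∇G′`, `G′`, `S⁻¹`), diagonal profiles (`π^L`, `π^F`), staircases (`J`, `Q′*`) and block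
means (`Q′`); if the letters are supplied in the LOCALISED form of [B5] (1.110) — per-block row sums decaying like `e^{−δ|y−y′|}` — the
composite kernels decay, at the cost of halving the rate and a factor `K_{d+1}(δ/2) = B4Sect5Proof.latticeConst (d+1) (δ/2)` per
composition (the volume-uniform torus sum `B5Hk163TorusHolderRate.sum_exp_torusSupNorm_sub_rep_le`).  THIS FILE (dimension written
`d + 1`, the convention of the torus-distance engine `B4TorusKernel.MultiPeriod.torusSupNorm`; all carriers index their unit block by a
«block map» `β : ι → Tor M` — `blockOf n M` on a fine lattice, `id` on the unit lattice):
 * §1 [shape] **`RowDecay βₒ βᵢ K C δ`** (`Σ_{x′ : βᵢ x′ = y′} ‖K(x,x′)‖ ≤ C·e^{−δ|βₒ x − y′|_{T,∞}}`) and [shape] **`FieldDecay βᵢ g b δ y′`**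
   (`‖g(z)‖ ≤ b·e^{−δ|βᵢ z − y′|_{T,∞}}`); monotonicity in the constant and the rate; `fieldDecay_of_supp` (a field supported over one
   unit site decays at every rate); `FieldDecay.add∕sub∕neg∕smul∕sum_univ`, `FieldDecay.mul_left` (bounded diagonal profiles);
 * §2 `exp_split_half`, the block swap `sum_eq_sum_blocks`, and THE RESUMMATION **`fieldDecay_mulVec`** (the torus triangle inequality from
   `T4EtaRateOperatorTorus.torusSupNorm_add_le`; cf. the NE2 lane's `SmallCouplingEntryDecay.torusSupNorm_rep_triangle`);
 * §3 transport through the cell's structural operators: `fieldDecay_stair` (`J`: `blockOf_{RN} = blockOf_N ∘ par`), `fieldDecay_blkInj`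
   (`Q′*`), `fieldDecay_QsOp` (`Q′`: a block mean is at most the block maximum), and `rowDecay_apply_of_supp` (a row-decaying kernel on a
   block-supported field).
HONEST SCOPE.  [folklore] bookkeeping (triangle inequality, geometric sums), no analysis; nothing of Bałaban's asserted ([B5] (1.110) p. 35
is a TEXT LOCATION for the SHAPE of the localised letters); NOT (CONV-C), NEVER «G-an2-4 closed», NOT NE2, NOT D1, NOT BetaPertH, NOT
continuum, NOT Clay; not in print — our bookkeeping.  HONEST DEPENDENCY: continuum YM on T⁴ ⇐ BetaPertH ∧ nine spine estimates (0/9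
proved); BetaPertH ⇐ (D1) ∧ (D4) ∧ CAP+tail; G-an2-4 gates asym, D1 and NE2/3/4.
-/

noncomputable section

open scoped BigOperators ComplexConjugate Matrix

namespace Summit.QuantumFields.BalabanUV.Beta.GAN24.BlockFieldDecay

open Literature.MathematicalPhysics.QuantumFieldTheory.Balaban1983to89
open B5Prop11Plancherel (Tor fine)
open B5Block118 (bpt QsOp QsOp_mulVec)
open B5Blocks16 (blockOf blockOf_bpt sum_blocks)
open B6LowerBound2153Torus (rep)
open B4TorusKernel.MultiPeriod (torusSupNorm)
open B4Sect5Proof (latticeConst latticeConst_nonneg)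
open B5Hk163TorusHolderRate (sum_exp_torusSupNorm_sub_rep_le)
open T4EtaRateOperatorTorus (torusSupNorm_add_le torusSupNorm_zero)
open Summit.QuantumFields.BalabanUV.T4Continuum.BalabanAveragedTowerModes (par)
open Summit.QuantumFields.BalabanUV.T4Continuum.ScalarPlantingDefect (blockOf_par)
open Summit.QuantumFields.BalabanUV.Beta.GAN24.StaircaseLaplacianDefect (stair stair_mulVec)
open Summit.QuantumFields.BalabanUV.Beta.GAN24.SoftMinimiserOneStepSup (blkInj blkInj_mulVec)

variable {d : ℕ} (M : Fin (d + 1) → ℕ) [hM : ∀ μ, NeZero (M μ)]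

/-! ## §1 The two shapes -/

/-- [shape] **PER-BLOCK ROW DECAY** of a kernel `K : ι × κ → ℂ` whose row index carries the block map `βₒ` and whose column index carries
`βᵢ` (both into the unit torus `Tor M`): `Σ_{x′ : βᵢ x′ = y′} ‖K(x, x′)‖ ≤ C·e^{−δ·|rep(βₒ x) − rep y′|_{T,∞}}` for every row `x` and every
unit site `y′` — the localised (1.110) letter currency (per-block row sums). [folklore] -/
def RowDecay {ι κ : Type*} [Fintype κ] (βo : ι → Tor M) (βi : κ → Tor M) (K : Matrix ι κ ℂ) (C δ : ℝ) : Prop :=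
  ∀ (x : ι) (y' : Tor M), (∑ x', if βi x' = y' then ‖K x x'‖ else 0)
    ≤ C * Real.exp (-(δ * torusSupNorm M (rep M (βo x) - rep M y')))

/-- [shape] **EXPONENTIAL DECAY OF A FIELD away from the unit site `y′`**: `‖g z‖ ≤ b·e^{−δ·|rep(βᵢ z) − rep y′|_{T,∞}}`. [folklore] -/
def FieldDecay {κ : Type*} (βi : κ → Tor M) (g : κ → ℂ) (b δ : ℝ) (y' : Tor M) : Prop :=
  ∀ z, ‖g z‖ ≤ b * Real.exp (-(δ * torusSupNorm M (rep M (βi z) - rep M y')))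

section Shapes

variable {M}
variable {ι κ : Type*} {βo : ι → Tor M} {βi : κ → Tor M}

omit hM in
/-- the torus distance from a unit site to itself vanishes. [folklore] -/
theorem tsn_self (a : Tor M) : torusSupNorm M (rep M a - rep M a) = 0 := by
  rw [sub_self]; exact torusSupNorm_zero M

omit hM in
/-- a decaying field over a nonempty carrier has a nonnegative constant. [folklore] -/
theorem FieldDecay.nonneg [Nonempty κ] {g : κ → ℂ} {b δ : ℝ} {y' : Tor M} (h : FieldDecay M βi g b δ y') : 0 ≤ b := by
  obtain ⟨z⟩ := ‹Nonempty κ›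
  have h1 : 0 * Real.exp (-(δ * torusSupNorm M (rep M (βi z) - rep M y')))
      ≤ b * Real.exp (-(δ * torusSupNorm M (rep M (βi z) - rep M y'))) := by
    rw [zero_mul]; exact (norm_nonneg _).trans (h z)
  exact le_of_mul_le_mul_right h1 (Real.exp_pos _)

/-- monotonicity of `FieldDecay` in the constant and the rate. [folklore] -/
theorem FieldDecay.mono {g : κ → ℂ} {b b' δ δ' : ℝ} {y' : Tor M} (h : FieldDecay M βi g b δ y') (hb : b ≤ b') (hb' : 0 ≤ b')
    (hδ : δ' ≤ δ) : FieldDecay M βi g b' δ' y' := fun z => by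
  refine (h z).trans ?_
  have ht : 0 ≤ torusSupNorm M (rep M (βi z) - rep M y') :=
    (B4TorusKernel.MultiPeriod.torusSupNorm_nonneg (fun i => Nat.one_le_iff_ne_zero.mpr (NeZero.ne (M i))) _)
  calc b * Real.exp (-(δ * torusSupNorm M (rep M (βi z) - rep M y')))
      ≤ b' * Real.exp (-(δ * torusSupNorm M (rep M (βi z) - rep M y'))) :=
        mul_le_mul_of_nonneg_right hb (Real.exp_pos _).le
    _ ≤ b' * Real.exp (-(δ' * torusSupNorm M (rep M (βi z) - rep M y'))) :=
        mul_le_mul_of_nonneg_left (Real.exp_le_exp.mpr (by nlinarith)) hb'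

/-- monotonicity of `RowDecay` in the constant and the rate. [folklore] -/
theorem RowDecay.mono [Fintype κ] {K : Matrix ι κ ℂ} {C C' δ δ' : ℝ} (h : RowDecay M βo βi K C δ) (hC : C ≤ C') (hC' : 0 ≤ C')
    (hδ : δ' ≤ δ) : RowDecay M βo βi K C' δ' := fun x y' => by
  refine (h x y').trans ?_
  have ht : 0 ≤ torusSupNorm M (rep M (βo x) - rep M y') :=
    (B4TorusKernel.MultiPeriod.torusSupNorm_nonneg (fun i => Nat.one_le_iff_ne_zero.mpr (NeZero.ne (M i))) _)
  calc C * Real.exp (-(δ * torusSupNorm M (rep M (βo x) - rep M y')))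
      ≤ C' * Real.exp (-(δ * torusSupNorm M (rep M (βo x) - rep M y'))) :=
        mul_le_mul_of_nonneg_right hC (Real.exp_pos _).le
    _ ≤ C' * Real.exp (-(δ' * torusSupNorm M (rep M (βo x) - rep M y'))) :=
        mul_le_mul_of_nonneg_left (Real.exp_le_exp.mpr (by nlinarith)) hC'

omit hM in
/-- a row-decaying kernel has a nonnegative constant (read at the own block of any row, if there is one). [folklore] -/
theorem RowDecay.nonneg [Fintype κ] [Nonempty ι] {K : Matrix ι κ ℂ} {C δ : ℝ} (h : RowDecay M βo βi K C δ) : 0 ≤ C := by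
  obtain ⟨x⟩ := ‹Nonempty ι›
  have h0 : (0 : ℝ) ≤ ∑ x', (if βi x' = βo x then ‖K x x'‖ else 0) :=
    Finset.sum_nonneg fun x' _ => by split_ifs <;> simp
  have h1 := h0.trans (h x (βo x))
  rw [tsn_self, mul_zero, neg_zero, Real.exp_zero, mul_one] at h1
  exact h1

omit hM in
/-- **a field supported over ONE unit site decays at every rate**: `g = 0` off `βᵢ⁻¹{y′}` and `|g| ≤ b` ⟹ `FieldDecay g b δ y′`. [folklore] -/
theorem fieldDecay_of_supp {g : κ → ℂ} {b : ℝ} (δ : ℝ) {y' : Tor M} (hb : ∀ z, ‖g z‖ ≤ b) (hs : ∀ z, βi z ≠ y' → g z = 0) :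
    FieldDecay M βi g b δ y' := fun z => by
  by_cases hz : βi z = y'
  · rw [hz, tsn_self, mul_zero, neg_zero, Real.exp_zero, mul_one]; exact hb z
  · rw [hs z hz, norm_zero]
    have hb0 : 0 ≤ b := (norm_nonneg _).trans (hb z)
    positivity

omit hM in
/-- sums of decaying fields decay. [folklore] -/
theorem FieldDecay.add {g₁ g₂ : κ → ℂ} {b₁ b₂ δ : ℝ} {y' : Tor M} (h₁ : FieldDecay M βi g₁ b₁ δ y') (h₂ : FieldDecay M βi g₂ b₂ δ y') :
    FieldDecay M βi (g₁ + g₂) (b₁ + b₂) δ y' := fun z => by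
  rw [Pi.add_apply, add_mul]
  exact (norm_add_le _ _).trans (add_le_add (h₁ z) (h₂ z))

omit hM in
/-- differences of decaying fields decay. [folklore] -/
theorem FieldDecay.sub {g₁ g₂ : κ → ℂ} {b₁ b₂ δ : ℝ} {y' : Tor M} (h₁ : FieldDecay M βi g₁ b₁ δ y') (h₂ : FieldDecay M βi g₂ b₂ δ y') :
    FieldDecay M βi (g₁ - g₂) (b₁ + b₂) δ y' := fun z => by
  rw [Pi.sub_apply, add_mul]
  exact (norm_sub_le _ _).trans (add_le_add (h₁ z) (h₂ z))

omit hM in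
/-- `−g` decays like `g`. [folklore] -/
theorem FieldDecay.neg {g : κ → ℂ} {b δ : ℝ} {y' : Tor M} (h : FieldDecay M βi g b δ y') : FieldDecay M βi (-g) b δ y' :=
  fun z => by rw [Pi.neg_apply, norm_neg]; exact h z

omit hM in
/-- a bounded diagonal profile does not spoil decay: `|π| ≤ ρ` ⟹ `FieldDecay (π·g) (ρb) δ y′`. [folklore] -/
theorem FieldDecay.mul_left {g : κ → ℂ} {b δ : ℝ} {y' : Tor M} (h : FieldDecay M βi g b δ y') (π : κ → ℂ) {ρ : ℝ}
    (hπ : ∀ z, ‖π z‖ ≤ ρ) : FieldDecay M βi (fun z => π z * g z) (ρ * b) δ y' := fun z => by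
  have hρ : 0 ≤ ρ := (norm_nonneg _).trans (hπ z)
  rw [norm_mul, mul_assoc]
  exact mul_le_mul (hπ z) (h z) (norm_nonneg _) hρ

omit hM in
/-- a scalar multiple: `FieldDecay (c • g) (‖c‖·b) δ y′`. [folklore] -/
theorem FieldDecay.smul {g : κ → ℂ} {b δ : ℝ} {y' : Tor M} (h : FieldDecay M βi g b δ y') (c : ℂ) :
    FieldDecay M βi (c • g) (‖c‖ * b) δ y' := fun z => by
  rw [Pi.smul_apply, smul_eq_mul, norm_mul, mul_assoc]
  exact mul_le_mul_of_nonneg_left (h z) (norm_nonneg _)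

omit hM in
/-- finite sums of decaying fields decay (constant `card·b`). [folklore] -/
theorem FieldDecay.sum_univ {α : Type*} [Fintype α] {g : α → κ → ℂ} {b δ : ℝ} {y' : Tor M}
    (h : ∀ i, FieldDecay M βi (g i) b δ y') : FieldDecay M βi (∑ i, g i) (Fintype.card α * b) δ y' := fun z => by
  rw [Finset.sum_apply, mul_assoc]
  calc ‖∑ i, g i z‖ ≤ ∑ i, ‖g i z‖ := norm_sum_le _ _
    _ ≤ ∑ _i : α, b * Real.exp (-(δ * torusSupNorm M (rep M (βi z) - rep M y'))) := Finset.sum_le_sum fun i _ => h i z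
    _ = Fintype.card α * (b * Real.exp (-(δ * torusSupNorm M (rep M (βi z) - rep M y')))) := by
        rw [Finset.sum_const, Finset.card_univ, nsmul_eq_mul]

end Shapes

/-! ## §2 The resummation -/

section Resum

variable {M}

omit hM in
/-- the exponential bookkeeping of one composition: for `t_ac ≤ t_ab + t_bc` (all `≥ 0`) and `δ ≥ 0`,
`e^{−δ t_ab}·e^{−δ t_bc} ≤ e^{−(δ/2) t_ac}·e^{−(δ/2) t_ab}`. [folklore] -/
theorem exp_split_half {δ tab tbc tac : ℝ} (hδ : 0 ≤ δ) (htri : tac ≤ tab + tbc) (hbc : 0 ≤ tbc) :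
    Real.exp (-(δ * tab)) * Real.exp (-(δ * tbc)) ≤ Real.exp (-(δ / 2 * tac)) * Real.exp (-(δ / 2 * tab)) := by
  rw [← Real.exp_add, ← Real.exp_add]
  exact Real.exp_le_exp.mpr (by nlinarith)

omit hM in
/-- the block swap: a sum over the column index is the sum over unit sites of the partial sums over their fibres. [folklore] -/
theorem sum_eq_sum_blocks {κ : Type*} [Fintype κ] [hM : ∀ μ, NeZero (M μ)] (βi : κ → Tor M) (F : κ → ℝ) :
    ∑ x', F x' = ∑ y'' : Tor M, ∑ x', (if βi x' = y'' then F x' else 0) := by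
  rw [Finset.sum_comm]
  refine Finset.sum_congr rfl fun x' _ => ?_
  rw [Finset.sum_ite_eq, if_pos (Finset.mem_univ _)]

/-- **THE RESUMMATION**: a row-decaying kernel maps a field decaying from `y′` to a field decaying from `y′`, with half the rate and the
constant multiplied by the volume-uniform torus sum `K_{d+1}(δ/2)`:
`RowDecay K C δ → FieldDecay g b δ y′ → FieldDecay (K·g) (C·b·K_{d+1}(δ/2)) (δ/2) y′` (`δ > 0`). [folklore] -/
theorem fieldDecay_mulVec {ι κ : Type*} [Fintype κ] {βo : ι → Tor M} {βi : κ → Tor M} {K : Matrix ι κ ℂ} {C δ : ℝ}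
    (hK : RowDecay M βo βi K C δ) (hδ : 0 < δ) {g : κ → ℂ} {b : ℝ} {y' : Tor M} (hg : FieldDecay M βi g b δ y') (hb : 0 ≤ b) :
    FieldDecay M βo (K *ᵥ g) (C * b * latticeConst (d + 1) (δ / 2)) (δ / 2) y' := by
  intro x
  have hC : 0 ≤ C := by
    have h0 : (0 : ℝ) ≤ ∑ x', (if βi x' = βo x then ‖K x x'‖ else 0) :=
      Finset.sum_nonneg fun x' _ => by split_ifs <;> simp
    have h1 := h0.trans (hK x (βo x))
    rwa [tsn_self, mul_zero, neg_zero, Real.exp_zero, mul_one] at h1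
  -- pointwise: ‖K x x′‖‖g x′‖ ≤ ‖K x x′‖·b·e^{−δ t(βᵢ x′, y′)}
  have step1 : ‖(K *ᵥ g) x‖ ≤ ∑ x', ‖K x x'‖ * (b * Real.exp (-(δ * torusSupNorm M (rep M (βi x') - rep M y')))) := by
    calc ‖(K *ᵥ g) x‖ = ‖∑ x', K x x' * g x'‖ := by simp only [Matrix.mulVec, dotProduct]
      _ ≤ ∑ x', ‖K x x' * g x'‖ := norm_sum_le _ _
      _ ≤ _ := Finset.sum_le_sum fun x' _ => by
          rw [norm_mul]; exact mul_le_mul_of_nonneg_left (hg x') (norm_nonneg _)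
  -- block swap and the per-block row bound
  have step2 : ∑ x', ‖K x x'‖ * (b * Real.exp (-(δ * torusSupNorm M (rep M (βi x') - rep M y'))))
      ≤ ∑ y'' : Tor M, C * Real.exp (-(δ * torusSupNorm M (rep M (βo x) - rep M y''))) *
          (b * Real.exp (-(δ * torusSupNorm M (rep M y'' - rep M y')))) := by
    rw [sum_eq_sum_blocks βi]
    refine Finset.sum_le_sum fun y'' _ => ?_
    have hrow := hK x y''
    calc ∑ x', (if βi x' = y'' then ‖K x x'‖ * (b * Real.exp (-(δ * torusSupNorm M (rep M (βi x') - rep M y')))) else 0)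
        = (∑ x', (if βi x' = y'' then ‖K x x'‖ else 0)) * (b * Real.exp (-(δ * torusSupNorm M (rep M y'' - rep M y')))) := by
          rw [Finset.sum_mul]
          refine Finset.sum_congr rfl fun x' _ => ?_
          split_ifs with h
          · rw [h]
          · rw [zero_mul]
      _ ≤ _ := mul_le_mul_of_nonneg_right hrow (by positivity)
  -- the exponential split and the torus sum
  have step3 : ∀ y'' : Tor M, C * Real.exp (-(δ * torusSupNorm M (rep M (βo x) - rep M y''))) *
        (b * Real.exp (-(δ * torusSupNorm M (rep M y'' - rep M y'))))
      ≤ C * b * Real.exp (-(δ / 2 * torusSupNorm M (rep M (βo x) - rep M y'))) *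
          Real.exp (-(δ / 2 * torusSupNorm M (rep M (βo x) - rep M y''))) := by
    intro y''
    -- the triangle inequality of the unit-torus distance (tree: `SmallCouplingEntryDecay.torusSupNorm_rep_triangle`, NE2 lane; re-derived
    -- inline from `T4EtaRateOperatorTorus.torusSupNorm_add_le` to keep this file's import closure inside road P2's)
    have htri : torusSupNorm M (rep M (βo x) - rep M y')
        ≤ torusSupNorm M (rep M (βo x) - rep M y'') + torusSupNorm M (rep M y'' - rep M y') := by
      have h := torusSupNorm_add_le M (rep M (βo x) - rep M y'') (rep M y'' - rep M y')
      rwa [show rep M (βo x) - rep M y'' + (rep M y'' - rep M y') = rep M (βo x) - rep M y' by abel] at h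
    have hsplit := exp_split_half hδ.le htri
      (B4TorusKernel.MultiPeriod.torusSupNorm_nonneg (fun i => Nat.one_le_iff_ne_zero.mpr (NeZero.ne (M i))) _)
    calc C * Real.exp (-(δ * torusSupNorm M (rep M (βo x) - rep M y''))) *
          (b * Real.exp (-(δ * torusSupNorm M (rep M y'' - rep M y'))))
        = C * b * (Real.exp (-(δ * torusSupNorm M (rep M (βo x) - rep M y''))) *
            Real.exp (-(δ * torusSupNorm M (rep M y'' - rep M y')))) := by ring
      _ ≤ C * b * (Real.exp (-(δ / 2 * torusSupNorm M (rep M (βo x) - rep M y'))) *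
            Real.exp (-(δ / 2 * torusSupNorm M (rep M (βo x) - rep M y'')))) :=
          mul_le_mul_of_nonneg_left hsplit (mul_nonneg hC hb)
      _ = _ := by ring
  have step4 : ∑ y'' : Tor M, Real.exp (-(δ / 2 * torusSupNorm M (rep M (βo x) - rep M y'')))
      ≤ latticeConst (d + 1) (δ / 2) := sum_exp_torusSupNorm_sub_rep_le M (half_pos hδ) (rep M (βo x))
  calc ‖(K *ᵥ g) x‖ ≤ _ := step1
    _ ≤ _ := step2
    _ ≤ ∑ y'' : Tor M, C * b * Real.exp (-(δ / 2 * torusSupNorm M (rep M (βo x) - rep M y'))) *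
          Real.exp (-(δ / 2 * torusSupNorm M (rep M (βo x) - rep M y''))) := Finset.sum_le_sum fun y'' _ => step3 y''
    _ = C * b * Real.exp (-(δ / 2 * torusSupNorm M (rep M (βo x) - rep M y'))) *
          ∑ y'' : Tor M, Real.exp (-(δ / 2 * torusSupNorm M (rep M (βo x) - rep M y''))) := by rw [Finset.mul_sum]
    _ ≤ C * b * Real.exp (-(δ / 2 * torusSupNorm M (rep M (βo x) - rep M y'))) * latticeConst (d + 1) (δ / 2) :=
        mul_le_mul_of_nonneg_left step4 (by positivity)
    _ = C * b * latticeConst (d + 1) (δ / 2) * Real.exp (-(δ / 2 * torusSupNorm M (rep M (βo x) - rep M y'))) := by ring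

omit hM in
/-- **a row-decaying kernel on a field supported over ONE unit site** keeps the full rate and constant:
`RowDecay K C δ → (|g| ≤ b, supp g ⊂ βᵢ⁻¹{y′}) → FieldDecay (K·g) (C·b) δ y′`. [folklore] -/
theorem rowDecay_apply_of_supp {ι κ : Type*} [Fintype κ] {βo : ι → Tor M} {βi : κ → Tor M} {K : Matrix ι κ ℂ} {C δ : ℝ}
    (hK : RowDecay M βo βi K C δ) {g : κ → ℂ} {b : ℝ} {y' : Tor M} (hb0 : 0 ≤ b) (hb : ∀ z, ‖g z‖ ≤ b)
    (hs : ∀ z, βi z ≠ y' → g z = 0) : FieldDecay M βo (K *ᵥ g) (C * b) δ y' := by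
  intro x
  calc ‖(K *ᵥ g) x‖ = ‖∑ x', K x x' * g x'‖ := by simp only [Matrix.mulVec, dotProduct]
    _ ≤ ∑ x', ‖K x x' * g x'‖ := norm_sum_le _ _
    _ ≤ ∑ x', (if βi x' = y' then ‖K x x'‖ else 0) * b := Finset.sum_le_sum fun x' _ => by
        rw [norm_mul]
        split_ifs with h
        · exact mul_le_mul_of_nonneg_left (hb x') (norm_nonneg _)
        · rw [hs x' h, norm_zero, mul_zero, zero_mul]
    _ = (∑ x', (if βi x' = y' then ‖K x x'‖ else 0)) * b := by rw [Finset.sum_mul]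
    _ ≤ C * Real.exp (-(δ * torusSupNorm M (rep M (βo x) - rep M y'))) * b := mul_le_mul_of_nonneg_right (hK x y') hb0
    _ = C * b * Real.exp (-(δ * torusSupNorm M (rep M (βo x) - rep M y'))) := by ring

end Resum

/-! ## §3 Transport through the structural operators `J`, `Q′*`, `Q′` -/

section Transport

variable {M}
variable (N R : ℕ) [NeZero N] [NeZero R]

/-- **the staircase transports decay**: `(Jf)(z) = f(par z)` and `blockOf_{RN} z = blockOf_N (par z)`. [folklore] -/
theorem fieldDecay_stair {f : Tor (fine N M) → ℂ} {b δ : ℝ} {y' : Tor M} (h : FieldDecay M (blockOf N M) f b δ y') :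
    FieldDecay M (blockOf (R * N) M) (stair N R M *ᵥ f) b δ y' := fun z => by
  rw [stair_mulVec, ← blockOf_par]; exact h (par N R M z)

/-- **`Q′*` transports decay**: `(Q′*v)(x) = v(blockOf x)`. [folklore] -/
theorem fieldDecay_blkInj {v : Tor M → ℂ} {b δ : ℝ} {y' : Tor M} (h : FieldDecay M id v b δ y') :
    FieldDecay M (blockOf N M) (blkInj N M *ᵥ v) b δ y' := fun x => by
  rw [blkInj_mulVec]; exact h (blockOf N M x)

/-- **the block mean transports decay**: `|(Q′f)(y)| ≤ max_{B(y)} |f| ≤ b·e^{−δ|y − y′|}`. [folklore] -/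
theorem fieldDecay_QsOp {f : Tor (fine N M) → ℂ} {b δ : ℝ} {y' : Tor M} (h : FieldDecay M (blockOf N M) f b δ y') :
    FieldDecay M id (QsOp N M *ᵥ f) b δ y' := fun y => by
  have hn : (0 : ℝ) < (N : ℝ) ^ (d + 1) := pow_pos (by exact_mod_cast Nat.pos_of_ne_zero (NeZero.ne N)) _
  have hn' : (N : ℝ) ^ (d + 1) ≠ 0 := hn.ne'
  have hcard : (Finset.univ : Finset (Fin (d + 1) → Fin N)).card = N ^ (d + 1) := by
    rw [Finset.card_univ, Fintype.card_fun, Fintype.card_fin, Fintype.card_fin]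
  rw [QsOp_mulVec, norm_mul, norm_div, norm_one, norm_pow, Complex.norm_natCast]
  have hpt : ∀ j : Fin (d + 1) → Fin N, ‖f (bpt N M y j)‖ ≤ b * Real.exp (-(δ * torusSupNorm M (rep M (id y) - rep M y'))) := by
    intro j
    have := h (bpt N M y j)
    rwa [blockOf_bpt] at this
  calc 1 / (N : ℝ) ^ (d + 1) * ‖∑ j : Fin (d + 1) → Fin N, f (bpt N M y j)‖
      ≤ 1 / (N : ℝ) ^ (d + 1) * ∑ _j : Fin (d + 1) → Fin N, b * Real.exp (-(δ * torusSupNorm M (rep M (id y) - rep M y'))) := by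
        refine mul_le_mul_of_nonneg_left ((norm_sum_le _ _).trans (Finset.sum_le_sum fun j _ => hpt j)) ?_
        positivity
    _ = b * Real.exp (-(δ * torusSupNorm M (rep M (id y) - rep M y'))) := by
        rw [Finset.sum_const, hcard, nsmul_eq_mul]; push_cast; field_simp

end Transport

end Summit.QuantumFields.BalabanUV.Beta.GAN24.BlockFieldDecay

end
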